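import Mathlib
import Literature.Topology.FourManifolds.PlanarAchiralWords
import HarnessLib

/-!
# Crux `ConvexBisection.PlanarAcyclicBisectionRigidity`, line Sketch — stub `stub_walkLow`

The walk for integral homotopy-sphere words `(n; A, B)` with `n ≤ 2` letters: `Mod(D_n, ∂)` is
abelian in the arc-data model, every positive twist on two holes is one of the three commuting,
multiplicatively independent round twists `T_[0,0]`, `T_[1,1]`, `T_[0,1]`, so equal monodromies of
two length-two positive factorisations have equal multisets of twists and an honest double
(`TwistEq`) is reached with at most one signed Hurwitz move.  Self-contained: the `ArcData` monoid
laws, multiplicativity of `evalWord`, on-the-nose inverse pairs and the conjugation table on two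
holes are proved here (sub-namespace `WalkLow`).  Unimodularity and normal generation are not used.
-/

noncomputable section

open Literature.Topology.FourManifolds.PlanarWords

set_option linter.dupNamespace false

namespace Summit.SmoothPoincare4.SmoothPoincare4.Theorems.PlanarAcyclicBisectionRigidity.Sketch

namespace WalkLow

open ArcData PGen FreeGroup

variable {n : ℕ}

/-! ## `ArcData n` is a monoid and `evalWord` is multiplicative -/

/-- Extensionality for arc data. [folklore] -/
theorem ext' {φ ψ : ArcData n} (h₁ : φ.perm = ψ.perm) (h₂ : ∀ i, φ.u i = ψ.u i) : φ = ψ := by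
  cases φ; cases ψ; simp only at h₁; subst h₁; simp only [ArcData.mk.injEq, true_and]; exact funext h₂

/-- The identity permutes nothing. [folklore] -/
@[simp] theorem one_perm : (one : ArcData n).perm = 1 := rfl
/-- The identity has trivial arc words. [folklore] -/
@[simp] theorem one_u (i : Fin n) : (one : ArcData n).u i = 1 := rfl
/-- Permutation of a composite. [folklore] -/
@[simp] theorem mul_perm (φ ψ : ArcData n) : (mul φ ψ).perm = φ.perm * ψ.perm := rfl
/-- Arc words of a composite. [folklore] -/
@[simp] theorem mul_u (φ ψ : ArcData n) (i : Fin n) :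
    (mul φ ψ).u i = φ.aut (ψ.u i) * φ.u (ψ.perm i) := rfl
/-- The induced automorphism on a generator. [folklore] -/
@[simp] theorem aut_of (φ : ArcData n) (i : Fin n) :
    φ.aut (of i) = φ.u i * of (φ.perm i) * (φ.u i)⁻¹ := FreeGroup.lift_apply_of

/-- The identity induces the identity of `F_n`. [folklore] -/
theorem aut_one : (one : ArcData n).aut = MonoidHom.id _ := by
  ext i; simp

/-- `(φψ)_* = φ_* ∘ ψ_*`. [folklore] -/
theorem aut_mul (φ ψ : ArcData n) : (mul φ ψ).aut = φ.aut.comp ψ.aut := by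
  ext i; simp [mul_assoc, Equiv.Perm.mul_apply]

/-- Composition of arc data is associative. [folklore] -/
theorem mul_assoc' (φ ψ χ : ArcData n) : mul (mul φ ψ) χ = mul φ (mul ψ χ) :=
  ext' (mul_assoc _ _ _) fun i => by simp [aut_mul, mul_assoc, Equiv.Perm.mul_apply]

/-- Left unit. [folklore] -/
@[simp] theorem one_mul' (φ : ArcData n) : mul one φ = φ :=
  ext' (one_mul _) fun i => by simp [aut_one]

/-- Right unit. [folklore] -/
@[simp] theorem mul_one' (φ : ArcData n) : mul φ one = φ :=
  ext' (mul_one _) fun i => by simp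

/-- `evalWord` of a cons (definitional). [folklore] -/
@[simp] theorem evalWord_cons (p : PGen) (g : List PGen) :
    evalWord n (p :: g) = mul (data n p) (evalWord n g) := rfl

/-- `evalWord` is multiplicative. [folklore] -/
theorem evalWord_append (g h : List PGen) :
    evalWord n (g ++ h) = mul (evalWord n g) (evalWord n h) := by
  induction g with
  | nil => simp [evalWord_nil]
  | cons p g ih => simp [ih, mul_assoc']

/-- Formal inverse of the empty word. [folklore] -/
@[simp] theorem invWord_nil : invWord [] = [] := rfl
/-- Formal inverse of a cons. [folklore] -/
@[simp] theorem invWord_cons (p : PGen) (g : List PGen) :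
    invWord (p :: g) = invWord g ++ [p.inv] := by
  simp [invWord]
/-- Formal inverse of a concatenation. [folklore] -/
theorem invWord_append (g h : List PGen) : invWord (g ++ h) = invWord h ++ invWord g := by
  simp [invWord]

/-- Formal inversion preserves the support condition. [folklore] -/
@[simp] theorem below_inv (p : PGen) : p.inv.below n = p.below n := by
  cases p <;> rfl

/-- Every letter of the twist word of an in-range curve is supported below `n`. [folklore] -/
theorem twist_below {c : PlanarCurve} (hc : c.InRange n) (s : Bool) :
    ∀ x ∈ c.twistWord s, x.below n = true := by
  obtain ⟨-, hb, hg⟩ := hc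
  intro x hx
  simp only [PlanarCurve.twistWord, List.mem_append, List.mem_singleton, invWord, List.mem_reverse,
    List.mem_map] at hx
  rcases hx with (hx | rfl) | ⟨y, hy, rfl⟩
  · exact hg x hx
  · simpa [PGen.below] using hb
  · simpa using hg y hy

/-- The twist word of an image curve `h(c)` is the formal conjugate `h · T_c^{±} · h⁻¹`, and the
negative twist word is the formal inverse of the positive one (Hurwitz bookkeeping). [folklore] -/
theorem twistWord_hurwitz (d₁ d₂ : PlanarCurve) :
    (hurwitzAct (d₂, false) (d₁, false)).1.twistWord true
      = invWord (d₂.twistWord true) ++ d₁.twistWord true ++ d₂.twistWord true := by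
  simp [hurwitzAct, PlanarCurve.image, Letter.twistWord, PlanarCurve.twistWord, invWord_append,
    invWord_invWord, PGen.inv]

/-! ## Two holes: the three round twists, the half-twist, inverse pairs and the conjugation table -/

/-- `x_[0,0] = x₀` on two holes. [folklore] -/
theorem blockWord00 : blockWord 2 0 0 = of 0 := by simp [blockWord, List.finRange_succ]
/-- `x_[1,1] = x₁` on two holes. [folklore] -/
theorem blockWord11 : blockWord 2 1 1 = of 1 := by simp [blockWord, List.finRange_succ]
/-- `x_[0,1] = x₀x₁` on two holes. [folklore] -/
theorem blockWord01 : blockWord 2 0 1 = of 0 * of 1 := by simp [blockWord, List.finRange_succ]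

/-- The three types of essential round curves on two holes: `c_[0,0]`, `c_[1,1]`, `c_[0,1]`.
[folklore] -/
inductive Ty | t00 | t11 | t01
  deriving DecidableEq, Fintype

/-- Arc data of the round twists `T_[0,0]^{∓}`, `T_[1,1]^{∓}`, `T_[0,1]^{∓}` on two holes
(`false` = positive twist). [folklore] -/
def R : Ty → Bool → ArcData 2
  | .t00, s => ⟨1, ![bif s then (of 0)⁻¹ else of 0, 1]⟩
  | .t11, s => ⟨1, ![1, bif s then (of 1)⁻¹ else of 1]⟩
  | .t01, s =>
    ⟨1, ![bif s then (of 0 * of 1)⁻¹ else of 0 * of 1, bif s then (of 0 * of 1)⁻¹ else of 0 * of 1]⟩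

/-- Round twists do not permute holes. [folklore] -/
@[simp] theorem R_perm (t : Ty) (s : Bool) : (R t s).perm = 1 := by cases t <;> rfl

/-- Arc data of the half-twist `σ₀^{±1}` on two holes (`false` = `σ₀`). [folklore] -/
def SS : Bool → ArcData 2
  | false => ⟨Equiv.swap 0 1, ![of 0, 1]⟩
  | true => ⟨Equiv.swap 0 1, ![1, (of 1)⁻¹]⟩

/-- `data 2 (σ₀^{±})` in normal form. [folklore] -/
theorem data_sigma (s : Bool) : data 2 (sigma 0 s) = SS s := by
  cases s <;> refine ext' (by simp [data, SS]) (fun i => ?_) <;> fin_cases i <;> simp [data, SS]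

/-- The type of the round curve `c_[a,b]`, `a ≤ b < 2`. [folklore] -/
def tyOf : ℕ → ℕ → Ty
  | 0, 0 => .t00
  | 0, _ => .t01
  | _, _ => .t11

/-- `data 2 (T_[a,b]^{∓})` in normal form for an essential round curve. [folklore] -/
theorem data_round (a b : ℕ) (s : Bool) (hab : a ≤ b) (hb : b < 2) :
    data 2 (round a b s) = R (tyOf a b) s := by
  interval_cases b <;> interval_cases a <;> cases s <;>
    refine ext' (by simp [data]) (fun i => ?_) <;> fin_cases i <;>
    simp [data, R, tyOf, blockWord00, blockWord01, blockWord11]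

/-- A round twist about an empty block is the identity. [folklore] -/
theorem data_round_degenerate (a b : ℕ) (s : Bool) (hab : b < a) : data n (round a b s) = one := by
  refine ext' rfl (fun i => ?_)
  simp [data]; intro h1 h2; omega

/-- `σ₀^{∓} σ₀^{±} = 1` on the nose. [folklore] -/
theorem SS_inv_mul (s : Bool) : mul (SS (!s)) (SS s) = one := by
  cases s <;> refine ext' (by simp [SS]) (fun i => ?_) <;> fin_cases i <;> simp [SS]

/-- `T^{±} T^{∓} = 1` on the nose for the three round twists. [folklore] -/
theorem R_inv_mul (t : Ty) (s : Bool) : mul (R t (!s)) (R t s) = one := by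
  cases t <;> cases s <;> refine ext' (by simp [R]) (fun i => ?_) <;> fin_cases i <;> simp [R] <;> group

/-- The half-twist exchanges the two one-hole types and fixes the boundary-parallel type.
[folklore] -/
def Ty.swap : Ty → Ty | .t00 => .t11 | .t11 => .t00 | .t01 => .t01

/-- CONJUGATION TABLE: `σ₀^{±} T_t σ₀^{∓} = T_{swap t}` on the nose. [folklore] -/
theorem SS_conj (s : Bool) (t : Ty) : mul (SS s) (mul (R t false) (SS (!s))) = R t.swap false := by
  cases s <;> cases t <;> refine ext' (by simp [SS, R, Ty.swap]) (fun i => ?_) <;> fin_cases i <;>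
    simp [SS, R, Ty.swap] <;> group

/-- The round twists on two holes pairwise commute (with either sign). [folklore] -/
theorem R_comm (t t' : Ty) (s : Bool) : mul (R t s) (R t' false) = mul (R t' false) (R t s) := by
  cases s <;> cases t <;> cases t' <;> refine ext' (by simp [R]) (fun i => ?_) <;> fin_cases i <;>
    simp [R] <;> group

/-- The action of a generator on types (half-twists swap, round twists fix). [folklore] -/
def act : PGen → Ty → Ty
  | .sigma _ _ => Ty.swap
  | .round _ _ _ => id

/-- Conjugation of a round twist by any supported generator is the round twist of the acted type.
[folklore] -/
theorem conj_gen (p : PGen) (hp : p.below 2 = true) (t : Ty) :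
    mul (data 2 p) (mul (R t false) (data 2 p.inv)) = R (act p t) false := by
  cases p with
  | sigma j s =>
    obtain rfl : j = 0 := by simp [PGen.below] at hp; omega
    simpa [PGen.inv, data_sigma, act] using SS_conj s t
  | round a b s =>
    rcases Nat.lt_or_ge b a with h | h
    · simp [PGen.inv, data_round_degenerate a b _ h, act]
    · have hb : b < 2 := by simpa [PGen.below] using hp
      simp only [PGen.inv, data_round a b _ h hb, act, id_eq]
      rw [← mul_assoc', R_comm, mul_assoc', ← Bool.not_not s, Bool.not_not (!s), R_inv_mul, mul_one']

/-- Inverse pair for any supported generator: `p⁻¹ p = 1` on the nose. [folklore] -/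
theorem inv_mul_gen (p : PGen) (hp : p.below 2 = true) : mul (data 2 p.inv) (data 2 p) = one := by
  cases p with
  | sigma j s =>
    obtain rfl : j = 0 := by simp [PGen.below] at hp; omega
    simpa [PGen.inv, data_sigma] using SS_inv_mul s
  | round a b s =>
    rcases Nat.lt_or_ge b a with h | h
    · simp [PGen.inv, data_round_degenerate a b _ h]
    · have hb : b < 2 := by simpa [PGen.below] using hp
      simp only [PGen.inv, data_round a b _ h hb, R_inv_mul]

/-- `g⁻¹ g = 1` on the nose for supported words on two holes. [folklore] -/
theorem evalWord_inv_mul (g : List PGen) (hg : ∀ x ∈ g, x.below 2 = true) :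
    mul (evalWord 2 (invWord g)) (evalWord 2 g) = one := by
  induction g with
  | nil => simp [evalWord_nil]
  | cons p g ih =>
    have hp : p.below 2 = true := hg p (by simp)
    have hg' : ∀ x ∈ g, x.below 2 = true := fun x hx => hg x (by simp [hx])
    calc mul (evalWord 2 (invWord (p :: g))) (evalWord 2 (p :: g))
        = mul (evalWord 2 (invWord g)) (mul (mul (data 2 p.inv) (data 2 p)) (evalWord 2 g)) := by
          simp only [invWord_cons, evalWord_append, evalWord_cons, evalWord_nil, mul_one', mul_assoc']
      _ = one := by rw [inv_mul_gen p hp, one_mul', ih hg']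

/-- CLASSIFICATION ENGINE: `g T_t g⁻¹ = T_{g • t}` on the nose for supported words. [folklore] -/
theorem evalWord_conj (g : List PGen) (hg : ∀ x ∈ g, x.below 2 = true) (t : Ty) :
    mul (evalWord 2 g) (mul (R t false) (evalWord 2 (invWord g))) = R (g.foldr act t) false := by
  induction g with
  | nil => simp [evalWord_nil]
  | cons p g ih =>
    have hp : p.below 2 = true := hg p (by simp)
    have hg' : ∀ x ∈ g, x.below 2 = true := fun x hx => hg x (by simp [hx])
    calc mul (evalWord 2 (p :: g)) (mul (R t false) (evalWord 2 (invWord (p :: g))))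
        = mul (data 2 p) (mul (mul (evalWord 2 g) (mul (R t false) (evalWord 2 (invWord g))))
            (data 2 p.inv)) := by
          simp only [invWord_cons, evalWord_append, evalWord_cons, evalWord_nil, mul_one', mul_assoc']
      _ = R ((p :: g).foldr act t) false := by rw [ih hg', conj_gen p hp, List.foldr_cons]

/-- Every positive twist about an in-range curve on two holes is `T_[0,0]`, `T_[1,1]` or `T_[0,1]`
as arc data. [folklore] -/
theorem twist_classify (c : PlanarCurve) (hc : c.InRange 2) :
    ∃ t : Ty, evalWord 2 (c.twistWord true) = R t false := by
  obtain ⟨hab, hb, hg⟩ := hc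
  refine ⟨c.g.foldr act (tyOf c.a c.b), ?_⟩
  rw [← evalWord_conj c.g hg, PlanarCurve.twistWord, evalWord_append, evalWord_append, evalWord_cons,
    evalWord_nil, mul_one', mul_assoc', Bool.not_true, data_round _ _ _ hab hb]

/-! ## The exponent-sum invariant separating products of two round twists -/

/-- Total exponent sum `F₂ → ℤ`. [folklore] -/
def eps : FreeGroup (Fin 2) →* Multiplicative ℤ := FreeGroup.lift fun _ => Multiplicative.ofAdd 1

/-- Induced automorphisms of arc data preserve the exponent sum (they conjugate-permute the
generators). [folklore] -/
theorem eps_aut (φ : ArcData 2) (x : FreeGroup (Fin 2)) : eps (φ.aut x) = eps x := by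
  suffices h : eps.comp φ.aut = eps from DFunLike.congr_fun h x
  ext i; simp [eps, mul_inv_cancel_comm]

/-- The degree vector `(ε(u₀), ε(u₁)) ∈ ℤ²` of arc data. [folklore] -/
def D (φ : ArcData 2) : ℤ × ℤ := ((eps (φ.u 0)).toAdd, (eps (φ.u 1)).toAdd)

/-- The degree vector is additive against non-permuting arc data. [folklore] -/
theorem D_mul (φ ψ : ArcData 2) (h : ψ.perm = 1) : D (mul φ ψ) = D φ + D ψ := by
  simp [D, h, eps_aut, add_comm]

/-- Degree vectors of the three round twists. [folklore] -/
def Ty.deg : Ty → ℤ × ℤ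
  | .t00 => (1, 0)
  | .t11 => (0, 1)
  | .t01 => (2, 2)

/-- The degree vectors of the three positive round twists, computed. [folklore] -/
theorem D_R (t : Ty) : D (R t false) = t.deg := by
  cases t <;> simp [D, R, Ty.deg, eps]

/-- The six sums of two degree vectors are pairwise distinct: equal sums force equal multisets.
[folklore] -/
theorem Ty.key (p q r s : Ty) (h : p.deg + q.deg = r.deg + s.deg) :
    (p = r ∧ q = s) ∨ (p = s ∧ q = r) := by
  revert p q r s h; decide

/-! ## The walk on two holes -/

/-- The monodromy of a two-letter positive word is the product of the two twists. [folklore] -/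
theorem monodromy_two (c d : PlanarCurve) :
    monodromy 2 (positiveWord [c, d])
      = mul (evalWord 2 (c.twistWord true)) (evalWord 2 (d.twistWord true)) := by
  simp [monodromy, positiveWord, Letter.twistWord, evalWord_append]

/-- After the Hurwitz move `(T_{d₂}⁻, T_{d₁}⁻) ↦ (T_{d₂}⁻(d₁)⁻, T_{d₂}⁻)` the new curve's positive
twist is `T_{d₂}⁻¹ T_{d₁} T_{d₂} = T_{d₁}` (abelian case). [folklore] -/
theorem hurwitz_twist (d₁ d₂ : PlanarCurve) (h₂ : d₂.InRange 2) (s₁ s₂ : Ty)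
    (hs₁ : evalWord 2 (d₁.twistWord true) = R s₁ false)
    (hs₂ : evalWord 2 (d₂.twistWord true) = R s₂ false) :
    evalWord 2 ((hurwitzAct (d₂, false) (d₁, false)).1.twistWord true) = R s₁ false := by
  rw [twistWord_hurwitz, evalWord_append, evalWord_append, hs₁, mul_assoc', hs₂, R_comm, ← mul_assoc',
    ← hs₂, evalWord_inv_mul _ (twist_below h₂ true), one_mul']

/-- The case `n = 2`: zero or one Hurwitz move reaches an honest double. [folklore] -/
theorem walk_two (c₁ c₂ d₁ d₂ : PlanarCurve) (h₁ : c₁.InRange 2) (h₂ : c₂.InRange 2)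
    (h₃ : d₁.InRange 2) (h₄ : d₂.InRange 2)
    (hmon : monodromy 2 (positiveWord [c₁, c₂]) = monodromy 2 (positiveWord [d₁, d₂])) :
    ∃ (n' : ℕ) (A' B' : List PlanarCurve),
      Reachable (2, blockForm [c₁, c₂] [d₁, d₂]) (n', blockForm A' B') ∧
        (SeamTrivial n' A' ∨ TwistEq n' A' B') := by
  obtain ⟨t₁, ht₁⟩ := twist_classify c₁ h₁
  obtain ⟨t₂, ht₂⟩ := twist_classify c₂ h₂
  obtain ⟨s₁, hs₁⟩ := twist_classify d₁ h₃
  obtain ⟨s₂, hs₂⟩ := twist_classify d₂ h₄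
  have hdeg : t₁.deg + t₂.deg = s₁.deg + s₂.deg := by
    rw [← D_R, ← D_R, ← D_R, ← D_R, ← D_mul _ _ (R_perm _ _), ← D_mul _ _ (R_perm _ _), ← ht₁, ← ht₂,
      ← hs₁, ← hs₂, ← monodromy_two, ← monodromy_two, hmon]
  rcases Ty.key _ _ _ _ hdeg with ⟨rfl, rfl⟩ | ⟨rfl, rfl⟩
  · exact ⟨2, [c₁, c₂], [d₁, d₂], Reachable.refl _, Or.inr
      (List.Forall₂.cons (ht₁.trans hs₁.symm) (List.Forall₂.cons (ht₂.trans hs₂.symm) List.Forall₂.nil))⟩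
  · exact ⟨2, [c₁, c₂], [d₂, (hurwitzAct (d₂, false) (d₁, false)).1],
      Move.reachable (Move.hurwitz 2 [(c₁, true), (c₂, true)] [] (d₂, false) (d₁, false)), Or.inr
      (List.Forall₂.cons (ht₁.trans hs₂.symm) (List.Forall₂.cons
        (ht₂.trans (hurwitz_twist d₁ d₂ h₄ _ _ hs₁ hs₂).symm) List.Forall₂.nil))⟩

end WalkLow

/-- **Stub 4 of the line Sketch — THE WALK FOR `n ≤ 2` LETTERS (`k ≤ 3` binding components).**
Every integral homotopy-sphere word `(n; A, B)` with `n ≤ 2` walks (by at most one signed Hurwitz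
move, no stabilisation) to a block form whose two blocks are twist-equal (an honest double).
`n = 0`: the empty word; `n = 1`: `monodromy_eq` is literally `TwistEq 1 [a] [b]`; `n = 2`: every
positive twist about an in-range curve on two holes equals `T_[0,0]`, `T_[1,1]` or `T_[0,1]` as arc
data (`WalkLow.twist_classify`), these commute and their pairwise products are separated by the
exponent-sum vector, so the two factorisations agree as multisets; if they agree in order no move
is needed, otherwise one Hurwitz move on the negative pair swaps them semantically
(`WalkLow.hurwitz_twist`).  Unimodularity and normal generation are not needed. [folklore] -/
theorem stub_walkLow (n : ℕ) (A B : List PlanarCurve) (hw : IsIntegralSphereWord n A B) (hn : n ≤ 2) :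
    ∃ (n' : ℕ) (A' B' : List PlanarCurve),
      Reachable (n, blockForm A B) (n', blockForm A' B') ∧ (SeamTrivial n' A' ∨ TwistEq n' A' B') := by
  obtain ⟨hin, hA, hB, hmon, -, -, -⟩ := hw
  interval_cases n
  · obtain rfl : A = [] := List.eq_nil_of_length_eq_zero hA
    obtain rfl : B = [] := List.eq_nil_of_length_eq_zero hB
    exact ⟨0, [], [], Reachable.refl _, Or.inr (TwistEq.refl 0 [])⟩
  · obtain ⟨a, rfl⟩ := List.length_eq_one_iff.1 hA
    obtain ⟨b, rfl⟩ := List.length_eq_one_iff.1 hB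
    refine ⟨1, [a], [b], Reachable.refl _, Or.inr (List.Forall₂.cons ?_ List.Forall₂.nil)⟩
    simpa [monodromy, positiveWord, Letter.twistWord] using hmon
  · obtain ⟨c₁, c₂, rfl⟩ := List.length_eq_two.1 hA
    obtain ⟨d₁, d₂, rfl⟩ := List.length_eq_two.1 hB
    exact WalkLow.walk_two c₁ c₂ d₁ d₂ (hin c₁ (by simp)) (hin c₂ (by simp)) (hin d₁ (by simp))
      (hin d₂ (by simp)) hmon

end Summit.SmoothPoincare4.SmoothPoincare4.Theorems.PlanarAcyclicBisectionRigidity.Sketch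

end
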